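import Literature.AlgebraicGeometry.Frobenioids.ModelFrobenioidFunctorIso
import Literature.AlgebraicGeometry.Frobenioids.ArithmeticFrobenioidRealificationHypotheses
import Literature.AlgebraicGeometry.Frobenioids.BaseSectionsOfObjectsCor57NonVacuity
import Literature.AlgebraicGeometry.Frobenioids.FrobenioidRealificationCanonical
import HarnessLib

/-!
# Frobenioids I, Thm. 5.2 (i) / Prop. 5.3 / Cor. 5.4: unit-free rigidity of the model Frobenioids of
# subfunctor data `(Φ, Ψ ↪ Φ^gp)` — every realification `C^rlf` and unit-trivialisation `C^un-tr` is
# RIGID OVER ITS ELEMENTARY FROBENIOID — and the instance at THE realified arithmetic Frobenioid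
# `𝒞⊩_mod = C_{L/L}^rlf` of Example 6.3 (the [IUTchI] Example 3.5 carrier)

Mochizuki, *The geometry of Frobenioids I: the general theory*, Kyushu J. Math. **62** (2008) 293–400:
Theorem 5.2 (i) p. 100 (a morphism of the model Frobenioid of `(Φ, B, Div_B)` IS the quadruple
`(deg_Fr, Base, Div, u)` subject to relation (d)); Proposition 5.3 p. 103 ("the model Frobenioid associated to
the divisor monoid `Φ^rlf` … and the … monoid `ℝ · Φ^birat`", i.e. `B ↪ Φ^gp` an INCLUSION of a subfunctor of
groups); Corollary 5.4 p. 104 l. 2–6 ("1-unique functor"); Example 6.3 p. 113 / Theorem 6.4 (i) p. 114 (the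
arithmetic Frobenioid `C_{F̃/F}` and its realification) [cite: MochizukiFrdI2008, Thm. 5.2 (i) p.100]
[cite: MochizukiFrdI2008, Prop. 5.3 p.103] [cite: MochizukiFrdI2008, Cor. 5.4 p.104]
[cite: MochizukiFrdI2008, Ex. 6.3 p.113].  Consumer locus: Mochizuki, *Inter-universal Teichmüller theory I*,
Remark 5.2.1 (ii), kurims manuscript p. 143 l. 19–22, "it follows immediately … from the rigidity of the
divisor monoids associated to the Frobenioids that appear at each of the components at `v ∈ 𝕍` of an
`ℱ`-prime-strip" — the rigidity of the global REALIFIED datum `†𝔉^⊩_mod` over its components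
[cite: Mochizuki2012, Rmk. 5.2.1 (ii) p.143] (abc-iut cell: the `ComponentIsoInjective` law of
`HodgeTheaterModelFKitCor56iLaws.lean`, merge object (m4) of the L5 HUB / field `I.m4` of the L5 base-merge
race).

PROOF-ONLY (seat abc-iut-L1-t3 gen 11; no definitions).  abc-iut-L1-t10's device
`ModelFrobenioid.nonempty_iso_of_agree` (`ModelFrobenioidFunctorIso.lean`) says: two functors into a model
Frobenioid whose rational-function monoid `B₂` is GROUP-LIKE with INJECTIVE `Div_{B₂}`, agreeing on bases,
Frobenius degrees and divisors, are isomorphic.  Both side conditions hold BY CONSTRUCTION for every model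
`Ψ₀.ModelOf = ModelFrobenioid Φ Ψ₀.toMonoid Ψ₀.incl` of a subfunctor of groups `Ψ₀ ⊆ Φ^gp`
(`GroupSubfunctors.lean`: `GpSubfunctor.isUnit_toMonoid`, and `Ψ₀.incl` is a subtype inclusion) — these are
exactly the tree's `C^un-tr`-model (`Ψ₀ = Φ^birat`), `(C^un-tr)^pf`-model and EVERY realification
`C^rlf = (R.realSpan Φ^birat).ModelOf` (`FrobenioidRealification.lean` `realification`,
`FrobenioidRealificationCanonical.lean` `PreFrobenioid.rlf`).  Hence, with `G₂ := 𝟭`, `H := 𝟭`: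

* `GpSubfunctor.ModelOf.nonempty_iso_id_of_over_base` — **every endofunctor `Ψ` of `Ψ₀.ModelOf` lying over the
  identity of the base (`η : Ψ ⋙ Base ≅ Base`) that preserves Frobenius degrees and divisors through `η` is
  isomorphic to `𝟭`** — NO hypothesis on units: the units `𝒪^×` of such a model are trivial, so the unit-twist
  self-equivalences that make the corresponding LAW unsatisfiable at Frobenioids with non-trivial units
  (abc-iut-L1-t7 gen 9, FINDING F1 on `ModelFrobenioidSelfEquivalenceRigidity.lean`, STATUS 2026-08-27
  04:02:49Z) do not exist here; equivalently the model is RIGID OVER ITS ELEMENTARY FROBENIOID `F_Φ`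
  (base + `deg_Fr` + `Div` are precisely the data of the structure functor `C → F_Φ`, Def. 1.1 (iii)/Thm. 5.2 (i));
* `GpSubfunctor.ModelOf.nonempty_iso_of_over_base` — the two-functor form (`Ψ₁, Ψ₂` agreeing through a natural
  base identification);
* `GpSubfunctor.ModelOf.nonempty_iso_id_of_iso_over_toElem` — the same read off ONE isomorphism
  `ε : Ψ ⋙ (C → F_Φ) ≅ (C → F_Φ)` over the structure functor (sharp `Φ`: the components of `ε` have
  `deg_Fr = 1`, `Div = 0`) — "`Ψ₀.ModelOf` is rigid over its elementary Frobenioid";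
* `PreFrobenioid.rlf_nonempty_iso_id_of_over_base` / `…_of_iso_over_toElem` — the same at the realification
  `C^rlf` of ANY Frobenioid structure functor `F : C ⥤ F_Φ` with perf-factorial `Φ` (Prop. 5.3), spelled on
  `PreFrobenioid.rlf F hΦ` (`Φ^rlf` is sharp: `IsPerfFactorial.Rlf.isSharp`);
* `arithRlf_nonempty_iso_id_of_over_base` / `…_of_iso_over_toElem` — the instance at THE genuine `𝒞⊩_mod := C_{L/L}^rlf` of a number
  field `L` (print's `F_mod`; Ex. 6.3 / Thm. 6.4 (i) realified, hypothesis-free: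
  `arith_objectwise_isPerfFactorial`), the category that inhabits the `‡𝒞^⊩ ≅ 𝒞^⊩_mod` slot of [IUTchI]
  Example 3.5.

Nothing of either paper is restated as a fact; no statement is strengthened (Cor. 5.4's "1-unique" is print's
word for this uniqueness up to isomorphism); nothing here bears on [IUTchIII] Cor. 3.12; theorems about OUR
model categories.
-/

namespace Literature.AlgebraicGeometry.Frobenioids

open CategoryTheory Opposite Literature.AnabelianGeometry.EtaleTheta

universe w v u v' u'

namespace GpSubfunctor.ModelOf

variable {D : Type u} [Category.{v} D] {Φ : Dᵒᵖ ⥤ CommMonCat.{w}} (Ψ₀ : GpSubfunctor Φ)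

/-- The rational-function monoid `Ψ₀` of the model `Ψ₀.ModelOf` is group-like (Thm. 5.2 hypothesis on `B`,
here automatic: `Ψ₀(X)` is a subgroup of `Φ(X)^gp`). [cite: MochizukiFrdI2008, Thm. 5.2 (i) p.100] -/
theorem isUnit_B (A : Dᵒᵖ) (u : Ψ₀.toMonoid.obj A) : IsUnit u :=
  Ψ₀.isUnit_toMonoid A u

/-- `Div_B = (Ψ₀ ↪ Φ^gp)` is injective on every object (Prop. 5.3: `B` IS a submonoid of `Φ^gp`), so the
units `𝒪^×(A) = Ker(Div_B)` of `Ψ₀.ModelOf` are trivial. [cite: MochizukiFrdI2008, Prop. 5.3 p.103] -/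
theorem divB_injective (A : Dᵒᵖ) :
    Function.Injective (divB Φ Ψ₀.toMonoid Ψ₀.incl A) :=
  fun _ _ h => Subtype.ext h

variable {Ψ₀}
variable {D₁ : Type u'} [Category.{v'} D₁] {Φ₁ B₁ : D₁ᵒᵖ ⥤ CommMonCat.{w}} {DivB₁ : B₁ ⟶ monoidGp Φ₁}

/-- **Two-functor rigidity into a subfunctor model** (Cor. 5.4 "1-unique", at the model of `(Φ, Ψ₀ ↪ Φ^gp)`):
two functors `G₁ G₂` from a model Frobenioid into `Ψ₀.ModelOf`, `G₁` lying over a base functor `H`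
(`γ₁`), identified on bases by a natural family `b`, both preserving Frobenius degrees and agreeing on
divisors through `b`, are isomorphic — abc-iut-L1-t10's `nonempty_iso_of_agree` with its two side
conditions DISCHARGED (`isUnit_B`, `divB_injective`). [cite: MochizukiFrdI2008, Cor. 5.4 p.104] -/
theorem nonempty_iso_of_over_base {H : D₁ ⥤ D}
    {G₁ G₂ : ModelFrobenioid Φ₁ B₁ DivB₁ ⥤ Ψ₀.ModelOf}
    (b : ∀ X : ModelFrobenioid Φ₁ B₁ DivB₁, (G₁.obj X).base ≅ (G₂.obj X).base)
    (hbn : ∀ ⦃X Y : ModelFrobenioid Φ₁ B₁ DivB₁⦄ (f : X ⟶ Y),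
      ModelFrobenioid.baseMap (G₁.map f) ≫ (b Y).hom = (b X).hom ≫ ModelFrobenioid.baseMap (G₂.map f))
    (hdeg₁ : ∀ ⦃X Y : ModelFrobenioid Φ₁ B₁ DivB₁⦄ (f : X ⟶ Y),
      ModelFrobenioid.degFr (G₁.map f) = ModelFrobenioid.degFr f)
    (hdeg₂ : ∀ ⦃X Y : ModelFrobenioid Φ₁ B₁ DivB₁⦄ (f : X ⟶ Y),
      ModelFrobenioid.degFr (G₂.map f) = ModelFrobenioid.degFr f)
    (hdiv : ∀ ⦃X Y : ModelFrobenioid Φ₁ B₁ DivB₁⦄ (f : X ⟶ Y),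
      ModelFrobenioid.div (G₁.map f) = (Φ.map (b X).hom.op).hom (ModelFrobenioid.div (G₂.map f)))
    (γ₁ : G₁ ⋙ ModelFrobenioid.baseFunctor Φ Ψ₀.toMonoid Ψ₀.incl ≅
      ModelFrobenioid.baseFunctor Φ₁ B₁ DivB₁ ⋙ H) :
    Nonempty (G₁ ≅ G₂) :=
  ModelFrobenioid.nonempty_iso_of_agree b hbn hdeg₂ hdiv hdeg₁ γ₁ (isUnit_B Ψ₀) (divB_injective Ψ₀)

/-- **Unit-free self-functor rigidity of a subfunctor model — `Ψ₀.ModelOf` is RIGID OVER `F_Φ`**: an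
endofunctor `Ψ` of `Ψ₀.ModelOf` lying over the identity of the base (`η : Ψ ⋙ Base ≅ Base`) that preserves
Frobenius degrees and divisors through `η` is isomorphic to `𝟭` — no hypothesis on units (they are
trivial), no `hratio`.  This is the form the [IUTchI] Rmk. 5.2.1 (ii) "rigidity of the divisor monoids" of a
REALIFIED global datum consumes. [cite: MochizukiFrdI2008, Cor. 5.4 p.104] -/
theorem nonempty_iso_id_of_over_base (Ψ : Ψ₀.ModelOf ⥤ Ψ₀.ModelOf)
    (η : Ψ ⋙ ModelFrobenioid.baseFunctor Φ Ψ₀.toMonoid Ψ₀.incl ≅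
      ModelFrobenioid.baseFunctor Φ Ψ₀.toMonoid Ψ₀.incl)
    (hdeg : ∀ ⦃X Y : Ψ₀.ModelOf⦄ (f : X ⟶ Y),
      ModelFrobenioid.degFr (Ψ.map f) = ModelFrobenioid.degFr f)
    (hdiv : ∀ ⦃X Y : Ψ₀.ModelOf⦄ (f : X ⟶ Y),
      ModelFrobenioid.div (Ψ.map f) = (Φ.map (η.app X).hom.op).hom (ModelFrobenioid.div f)) :
    Nonempty (Ψ ≅ 𝟭 Ψ₀.ModelOf) := by
  refine nonempty_iso_of_over_base (H := 𝟭 D) (G₂ := 𝟭 Ψ₀.ModelOf) (fun X => η.app X)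
    (fun X Y f => ?_) hdeg (fun X Y f => rfl) hdiv (η ≪≫ (Functor.rightUnitor _).symm)
  exact η.hom.naturality f

/-! #### The same rigidity in the currency of the structure functor `C → F_Φ` ("isomorphisms of
Frobenioids": an endofunctor together with an isomorphism `Ψ ⋙ (C → F_Φ) ≅ (C → F_Φ)`) -/

/-- In `F_Φ` the components of a natural ISOMORPHISM have Frobenius degree `1` (degrees multiply to
`deg_Fr(id) = 1` in `ℕ_{≥1}`). [cite: MochizukiFrdI2008, Def. 1.1 (iii) p.19] -/
theorem degFr_app_eq_one_of_iso {C' : Type u'} [Category.{v'} C'] {G₁ G₂ : C' ⥤ ElemFrobenioid Φ}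
    (ε : G₁ ≅ G₂) (X : C') :
    ElemFrobenioid.degFr (ε.hom.app X) = 1 ∧ ElemFrobenioid.degFr (ε.inv.app X) = 1 := by
  have h := congrArg ElemFrobenioid.degFr (ε.hom_inv_id_app X)
  rw [ElemFrobenioid.degFr_comp, ElemFrobenioid.degFr_id] at h
  exact (mul_eq_one_iff_of_one_le one_le one_le).mp h

/-- In `F_Φ` with SHARP `Φ` (no units — e.g. every `Φ^rlf`, `IsPerfFactorial.Rlf.isSharp`) the components of
a natural isomorphism have trivial zero divisor. [cite: MochizukiFrdI2008, Def. 1.1 (iii) p.19] -/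
theorem div_app_eq_one_of_iso (hΦ : ∀ A : Dᵒᵖ, IsSharp (Φ.obj A)) {C' : Type u'} [Category.{v'} C']
    {G₁ G₂ : C' ⥤ ElemFrobenioid Φ} (ε : G₁ ≅ G₂) (X : C') :
    ElemFrobenioid.Div (ε.hom.app X) = 1 := by
  have h := congrArg ElemFrobenioid.Div (ε.hom_inv_id_app X)
  rw [ElemFrobenioid.div_comp, ElemFrobenioid.div_id, (degFr_app_eq_one_of_iso ε X).2, PNat.one_coe,
    pow_one] at h
  exact (hΦ _).eq_one_of_isUnit _ (IsUnit.of_mul_eq_one_right _ h)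

/-- **`Ψ₀.ModelOf` is RIGID OVER ITS ELEMENTARY FROBENIOID** (sharp `Φ`): an endofunctor `Ψ` of the model
of `(Φ, Ψ₀ ↪ Φ^gp)` together with an isomorphism `ε : Ψ ⋙ (C → F_Φ) ≅ (C → F_Φ)` over the structure functor
of Thm. 5.2 (i) (`ModelFrobenioid.toElem`) is `≅ 𝟭` — the base identification, `deg_Fr`- and
`Div`-compatibilities are READ OFF `ε` (its components have degree `1` and divisor `0`), and no unit datum is
needed. [cite: MochizukiFrdI2008, Cor. 5.4 p.104] -/
theorem nonempty_iso_id_of_iso_over_toElem (hΦ : ∀ A : Dᵒᵖ, IsSharp (Φ.obj A))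
    (Ψ : Ψ₀.ModelOf ⥤ Ψ₀.ModelOf)
    (ε : Ψ ⋙ ModelFrobenioid.toElem Φ Ψ₀.toMonoid Ψ₀.incl ≅ ModelFrobenioid.toElem Φ Ψ₀.toMonoid Ψ₀.incl) :
    Nonempty (Ψ ≅ 𝟭 Ψ₀.ModelOf) := by
  let η : Ψ ⋙ ModelFrobenioid.baseFunctor Φ Ψ₀.toMonoid Ψ₀.incl ≅
      ModelFrobenioid.baseFunctor Φ Ψ₀.toMonoid Ψ₀.incl :=
    NatIso.ofComponents (fun X => (ElemFrobenioid.baseFunctor Φ).mapIso (ε.app X)) fun {X Y} f => by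
      exact congrArg ElemFrobenioid.Base (ε.hom.naturality f)
  refine nonempty_iso_id_of_over_base Ψ η (fun X Y f => ?_) (fun X Y f => ?_)
  · have h := congrArg ElemFrobenioid.degFr (ε.hom.naturality f)
    rw [Functor.comp_map, ElemFrobenioid.degFr_comp, ElemFrobenioid.degFr_comp,
      (degFr_app_eq_one_of_iso ε Y).1, (degFr_app_eq_one_of_iso ε X).1, mul_one, one_mul] at h
    exact h
  · have h := congrArg ElemFrobenioid.Div (ε.hom.naturality f)
    rw [Functor.comp_map, ElemFrobenioid.div_comp, ElemFrobenioid.div_comp, div_app_eq_one_of_iso hΦ ε Y,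
      div_app_eq_one_of_iso hΦ ε X, map_one, one_mul, one_pow, mul_one, (degFr_app_eq_one_of_iso ε Y).1,
      PNat.one_coe, pow_one] at h
    exact h

end GpSubfunctor.ModelOf

/-! ### The realification `C^rlf` of a Frobenioid (Prop. 5.3) -/

namespace PreFrobenioid

variable {D : Type u} [Category.{v} D] {Φ : Dᵒᵖ ⥤ CommMonCat.{w}}
  {C : Type u'} [Category.{v'} C] (F : C ⥤ ElemFrobenioid Φ) (hΦ : IsPerfFactorialOn Φ)

/-- **`C^rlf` is rigid over its elementary Frobenioid** (Prop. 5.3 / Cor. 5.4 at THE realification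
`PreFrobenioid.rlf F hΦ` of any Frobenioid structure functor `F` with perf-factorial `Φ`): an endofunctor of
`C^rlf` over the identity of the base preserving `deg_Fr` and `Div` is `≅ 𝟭`; the rational-function monoid
`ℝ · Φ^birat ↪ (Φ^rlf)^gp` being a subfunctor of groups, no unit hypothesis occurs.
[cite: MochizukiFrdI2008, Prop. 5.3 p.103] -/
theorem rlf_nonempty_iso_id_of_over_base (Ψ : rlf F hΦ ⥤ rlf F hΦ)
    (η : Ψ ⋙ ModelFrobenioid.baseFunctor _ _ _ ≅ ModelFrobenioid.baseFunctor _ _ _)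
    (hdeg : ∀ ⦃X Y : rlf F hΦ⦄ (f : X ⟶ Y),
      ModelFrobenioid.degFr (Ψ.map f) = ModelFrobenioid.degFr f)
    (hdiv : ∀ ⦃X Y : rlf F hΦ⦄ (f : X ⟶ Y),
      ModelFrobenioid.div (Ψ.map f) =
        ((rlfFunctor Φ (IsPerfFactorialOn.op hΦ)).map (η.app X).hom.op).hom (ModelFrobenioid.div f)) :
    Nonempty (Ψ ≅ 𝟭 (rlf F hΦ)) :=
  GpSubfunctor.ModelOf.nonempty_iso_id_of_over_base Ψ η hdeg hdiv

/-- **`C^rlf` is rigid over `F_{Φ^rlf}`** — the structure-functor currency: an endofunctor `Ψ` of THE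
realification with an isomorphism `Ψ ⋙ (C^rlf → F_{Φ^rlf}) ≅ (C^rlf → F_{Φ^rlf})` is `≅ 𝟭`; sharpness of
`Φ^rlf` (`IsPerfFactorial.Rlf.isSharp`) and the subgroup shape of `ℝ · Φ^birat` discharge every side
condition. [cite: MochizukiFrdI2008, Prop. 5.3 p.103] -/
theorem rlf_nonempty_iso_id_of_iso_over_toElem (Ψ : rlf F hΦ ⥤ rlf F hΦ)
    (ε : Ψ ⋙ rlfToElem F hΦ ≅ rlfToElem F hΦ) : Nonempty (Ψ ≅ 𝟭 (rlf F hΦ)) :=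
  GpSubfunctor.ModelOf.nonempty_iso_id_of_iso_over_toElem
    (fun A => IsPerfFactorial.Rlf.isSharp (IsPerfFactorialOn.op hΦ A)) Ψ ε

end PreFrobenioid

/-! ### THE realified arithmetic Frobenioid `𝒞⊩_mod = C_{L/L}^rlf` of a number field (Ex. 6.3 / Thm. 6.4 (i)) -/

section Arith

variable (L : Type) [Field L] [NumberField L]

/-- **Rigidity of THE genuine `𝒞⊩_mod`** — the realification (Prop. 5.3) of the arithmetic Frobenioid
`C_{L/L}` of Example 6.3 of a number field `L` (print's `F_mod` of [IUTchI] Example 3.5), a Frobenioid of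
isotropic type (`arithFrobenioid_rlf_isOfIsotropicType`): every endofunctor over the identity of the base
`ℬ(Gal(L/L))⁰` preserving Frobenius degrees and (realified arithmetic) divisors is `≅ 𝟭`.  Hypothesis-free
carrier (`arith_objectwise_isPerfFactorial`). [cite: MochizukiFrdI2008, Thm. 6.4 (i) p.114] -/
theorem arithRlf_nonempty_iso_id_of_over_base
    (Ψ : PreFrobenioid.rlf (ModelFrobenioid.toElem (arithDivisorFunctor L L) (unitsFunctor L L) (divNatTrans L L))
          (arith_objectwise_isPerfFactorial L L) ⥤
        PreFrobenioid.rlf (ModelFrobenioid.toElem (arithDivisorFunctor L L) (unitsFunctor L L) (divNatTrans L L))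
          (arith_objectwise_isPerfFactorial L L))
    (η : Ψ ⋙ ModelFrobenioid.baseFunctor _ _ _ ≅ ModelFrobenioid.baseFunctor _ _ _)
    (hdeg : ∀ ⦃X Y⦄ (f : X ⟶ Y), ModelFrobenioid.degFr (Ψ.map f) = ModelFrobenioid.degFr f)
    (hdiv : ∀ ⦃X Y⦄ (f : X ⟶ Y),
      ModelFrobenioid.div (Ψ.map f) =
        ((rlfFunctor (arithDivisorFunctor L L)
            (PreFrobenioid.IsPerfFactorialOn.op (arith_objectwise_isPerfFactorial L L))).map
          (η.app X).hom.op).hom (ModelFrobenioid.div f)) :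
    Nonempty (Ψ ≅ 𝟭 _) :=
  PreFrobenioid.rlf_nonempty_iso_id_of_over_base _ _ Ψ η hdeg hdiv

/-- **THE genuine `𝒞⊩_mod` is rigid over its elementary Frobenioid** ("isomorphisms of Frobenioids" currency,
the shape an [IUTchI] Ex. 3.5 ⊩-collection consumes): an endofunctor `Ψ` of `𝒞⊩_mod = C_{L/L}^rlf` with
`Ψ ⋙ (𝒞⊩_mod → F_{Φ^rlf}) ≅ (𝒞⊩_mod → F_{Φ^rlf})` is `≅ 𝟭`.  Hypothesis-free. [cite: MochizukiFrdI2008, Thm. 6.4 (i) p.114] -/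
theorem arithRlf_nonempty_iso_id_of_iso_over_toElem
    (Ψ : PreFrobenioid.rlf (ModelFrobenioid.toElem (arithDivisorFunctor L L) (unitsFunctor L L) (divNatTrans L L))
          (arith_objectwise_isPerfFactorial L L) ⥤
        PreFrobenioid.rlf (ModelFrobenioid.toElem (arithDivisorFunctor L L) (unitsFunctor L L) (divNatTrans L L))
          (arith_objectwise_isPerfFactorial L L))
    (ε : Ψ ⋙ PreFrobenioid.rlfToElem _ (arith_objectwise_isPerfFactorial L L) ≅
      PreFrobenioid.rlfToElem _ (arith_objectwise_isPerfFactorial L L)) :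
    Nonempty (Ψ ≅ 𝟭 _) :=
  PreFrobenioid.rlf_nonempty_iso_id_of_iso_over_toElem _ _ Ψ ε

/-- THE genuine `𝒞⊩_mod` IS a Frobenioid of isotropic type, hypothesis-free (Thm. 6.4 (i) `C^rlf` clause at
`K := L`, by abc-iut-w5-d137/abc-iut-L1's `arithFrobenioid_rlf_isFrobenioid'` and
`arith_objectwise_isPerfFactorial`; recorded here so the [IUTchI] Ex. 3.5 consumer cites ONE name).
[cite: MochizukiFrdI2008, Thm. 6.4 (i) p.114] -/
theorem arithRlf_isFrobenioid_and_isotropic :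
    PreFrobenioid.IsFrobenioid (PreFrobenioid.rlfToElem
        (ModelFrobenioid.toElem (arithDivisorFunctor L L) (unitsFunctor L L) (divNatTrans L L))
        (arith_objectwise_isPerfFactorial L L)) ∧
      PreFrobenioid.IsOfIsotropicType (PreFrobenioid.rlfToElem
        (ModelFrobenioid.toElem (arithDivisorFunctor L L) (unitsFunctor L L) (divNatTrans L L))
        (arith_objectwise_isPerfFactorial L L)) :=
  ⟨arithFrobenioid_rlf_isFrobenioid' L L _, arithFrobenioid_rlf_isOfIsotropicType L L _⟩

end Arith

end Literature.AlgebraicGeometry.Frobenioids
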